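import Mathlib
import Literature.NumberTheory.LFunctions.LiouvilleOneSided
import Literature.NumberTheory.LFunctions.TuranLiouvilleCriterionSqrt
import Literature.NumberTheory.LFunctions.TuranLiouvilleCriterionSharp
import HarnessLib

/-!
# One-sided bounds on `T(x)√x`: Landau's theorem and the Laplace transform of `B(u) = T(e^u)e^{u/2}`

Topic `Literature/NumberTheory/LFunctions` (trunk T-ANT). The number-theoretic input of Ingham's
kernel method for **Turán's sum** `T(x) = Σ_{n ≤ x} λ(n)/n` (the tree's `liouvilleHarmonicSum`),
companion of `LiouvilleOneSided.lean` (Pólya's sum) and `MertensOneSided.lean` (whose structure is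
followed; everything about `T` that the tree already has — measurability, `|T(x)| ≤ x`, the partial
summation, the zero-free strip, the continuation `Φ`, the thin rectangle `W₀`, the identity theorem on
`Re w > -½` — is imported from `TuranLiouvilleCriterion.lean`, `TuranLiouvilleCriterionSqrt.lean`,
`TuranLiouvilleCriterionSharp.lean` (namespaces `TuranLiouville`, `Turan1948`), which prove Turán's
criteria "`T(n) ≥ -c/√n` eventually ⟹ RH"): under a one-sided bound on `B(u) = e^{u/2} T(e^u)` (Borwein–Ferguson–Mossinghoff 2008,
(6)) the damped functions `B(u)e^{-σu}` are integrable for every `σ > 0` and the Laplace transform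
of `B` is `ζ(1+2s)/((s-½)ζ(½+s))` on `0 < Re s < ½` — the function whose polar parts give `B*` of
BFM (7) (constant term `-1/ζ(½)`, coefficients `ζ(2ρ)/((ρ-1)ζ'(ρ))`).

## Main results (all proved)

* `mellin_liouvilleHarmonicSum` — `∫_{(1,∞)} T(x) x^{-(w+1)} dx = ζ(2w+2)/ζ₁(w+1)` for `Re w > 1`
  (from the tree's `TuranLiouville.mellinIoi_mul_riemannZeta₁`, Mathlib's entire `ζ₁(s) = (s-1)ζ(s)`).
* `integrableOn_turan_rpow_of_oneSided` — **Landau's theorem applied to `T`**, in the form the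
  kernel theorem needs (both signs, conclusion = absolute convergence): a one-sided bound
  `±T(x) ≤ A/√x` (`x ≥ x₁`) gives `∫_1^∞ |T(x)| x^{-σ-1} dx < ∞` for every `σ > -½`. The proof only
  wires the tree's ingredients for `g = εT + c x^{-1/2}` (`TuranLiouvilleCriterionSqrt.lean`,
  namespace `Turan1948`: `integrableOn_gfun`, `differentiableAt_Phi`, `exists_W₀`,
  `mellinIoi_rpow_neg_half`, …, which there conclude RH rather than integrability) into Landau's lemma
  `Landau.integrableOn_of_differentiableOn_union_convex`. This is the analytic content of Turán's
  theorem "if `T(n) > -c/√n` for all sufficiently large `n`, then the Riemann hypothesis would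
  follow" (BFM 2008 §1 p. 1682) in integrated form.
* `mellin_turan_eq_of_integrable` — the representation `ζ(2w+2)/(wζ(w+1))` on `Re w > -½` (from the
  tree's `TuranLiouville.mellinIoi_mul_riemannZeta₁_eq_of_integrable`, `TuranLiouvilleCriterionSharp.lean`).
* `normalizedTuran`, `laplace_normalizedTuran_eq_mellin`, `normalizedTuran_laplace_of_oneSided` —
  `B(u) = T(e^u)e^{u/2}` and the packaged statement fed to the kernel theorem
  (`ZetaQuotientKernelTheorem.lean`, with `q(s) = 1/(s-½)`).

## References

* [BorweinFergusonMossinghoff2008] P. Borwein, R. Ferguson, M. J. Mossinghoff, *Sign changes in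
  sums of the Liouville function*, Math. Comp. 77 (2008), 1681–1694: §1, (1) p. 1681, p. 1682
  (Turán), (6)–(7) pp. 1683–1684.
* [Ingham1942] A. E. Ingham, *On two conjectures in the theory of numbers*, Amer. J. Math. 64
  (1942), 313–319.
* [MontgomeryVaughan2007] H. L. Montgomery, R. C. Vaughan, *Multiplicative Number Theory I*,
  §15.1 Lemma 15.1 (Landau).
-/

noncomputable section

open Complex Filter Asymptotics MeasureTheory Set ArithmeticFunction
open scoped Real Topology

namespace Literature.NumberTheory.LFunctions

open LiouvilleSum TuranLiouville

/-! ## `T(x)`: elementary facts -/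

/-- `T(x)` written over `Finset.Icc 1 ⌊x⌋₊`. [folklore] -/
theorem liouvilleHarmonicSum_eq_sum_Icc (x : ℝ) :
    liouvilleHarmonicSum x = ∑ n ∈ Finset.Icc 1 ⌊x⌋₊, (liouville n : ℝ) / n := by
  unfold liouvilleHarmonicSum
  rw [← Finset.Icc_add_one_left_eq_Ioc, zero_add]

/-- `T(x) = 0` for `x < 1`. [folklore] -/
theorem liouvilleHarmonicSum_of_lt_one {x : ℝ} (hx : x < 1) : liouvilleHarmonicSum x = 0 := by
  unfold liouvilleHarmonicSum
  rw [Nat.floor_eq_zero.2 hx]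
  simp

/-! ## The Mellin transform of `T` -/

/-- **The Mellin transform of `T`** in the form `∫_{(1,∞)} T(x) x^{-(w+1)} dx = ζ(2w+2)/ζ₁(w+1)`
for `Re w > 1`, with Mathlib's entire `ζ₁(s) = (s-1)ζ(s)` (`riemannZeta₁`) — the tree's
`TuranLiouville.mellinIoi_mul_riemannZeta₁` divided by `ζ₁(w+1) ≠ 0`.
[cite: BorweinFergusonMossinghoff2008, §1 (1) p. 1681] -/
theorem mellin_liouvilleHarmonicSum {w : ℂ} (hw : 1 < w.re) :
    Landau.mellinIoi liouvilleHarmonicSum w = riemannZeta (2 * w + 2) / riemannZeta₁ (w + 1) := by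
  have h := mellinIoi_mul_riemannZeta₁ hw
  have hζ₁ : riemannZeta₁ (w + 1) ≠ 0 := by
    intro h0
    rw [h0, mul_zero] at h
    exact riemannZeta_ne_zero_of_one_lt_re (s := 2 * w + 2) (by simp; linarith) h.symm
  rw [eq_div_iff hζ₁, h]

/-- `ζ₁(w+1) = w ζ(w+1)` for `w ≠ 0` (Mathlib's `riemannZeta_eq_inv_sub_mul`). [folklore] -/
theorem riemannZeta₁_add_one {w : ℂ} (hw : w ≠ 0) : riemannZeta₁ (w + 1) = w * riemannZeta (w + 1) := by
  have h1 : w + 1 ≠ 1 := by simpa using hw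
  rw [riemannZeta_eq_inv_sub_mul h1, add_sub_cancel_right, ← mul_assoc, mul_inv_cancel₀ hw, one_mul]

/-! ## `B(u) = T(e^u) e^{u/2}` ((6) of BFM 2008) -/

/-- `B(x) = e^{x/2} T(e^x)` (Borwein–Ferguson–Mossinghoff (6)): the function to which the abstract
oscillation theorem is applied for Turán's problem. [cite: BorweinFergusonMossinghoff2008, §1 (6) p. 1683] -/
def normalizedTuran (u : ℝ) : ℝ :=
  liouvilleHarmonicSum (Real.exp u) * Real.exp (u / 2)

/-- `B = 0` on `(-∞, 0)`. [cite: BorweinFergusonMossinghoff2008, §1 (6) p. 1683] -/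
theorem normalizedTuran_of_neg {u : ℝ} (hu : u < 0) : normalizedTuran u = 0 := by
  unfold normalizedTuran
  rw [liouvilleHarmonicSum_of_lt_one (Real.exp_lt_one_iff.2 hu)]
  simp

/-- `|B(u)| ≤ e^{3u/2}` (from `|T(x)| ≤ x`). [folklore] -/
theorem abs_normalizedTuran_le (u : ℝ) : |normalizedTuran u| ≤ Real.exp (3 * u / 2) := by
  unfold normalizedTuran
  rw [abs_mul, abs_of_pos (Real.exp_pos _)]
  calc |liouvilleHarmonicSum (Real.exp u)| * Real.exp (u / 2)
      ≤ Real.exp u * Real.exp (u / 2) :=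
        mul_le_mul_of_nonneg_right (abs_liouvilleHarmonicSum_le (Real.exp_pos u).le) (Real.exp_pos _).le
    _ = Real.exp (3 * u / 2) := by rw [← Real.exp_add]; congr 1; ring

/-- `B` is measurable. [folklore] -/
theorem measurable_normalizedTuran : Measurable normalizedTuran :=
  (measurable_liouvilleHarmonicSum.comp Real.measurable_exp).mul
    (Real.measurable_exp.comp (measurable_id.div_const 2))

/-- `B` is locally bounded. [folklore] -/
theorem normalizedTuran_locally_bounded (b : ℝ) :
    ∃ B : ℝ, ∀ u, u ≤ b → |normalizedTuran u| ≤ B :=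
  ⟨Real.exp (3 * b / 2), fun u hu ↦ (abs_normalizedTuran_le u).trans (Real.exp_le_exp.2 (by linarith))⟩

/-- From `B(y) > a` frequently to `T(x) √x > a` frequently (`x = e^y`).
[cite: BorweinFergusonMossinghoff2008, §1 (6) p. 1683] -/
theorem frequently_turan_gt_of_normalizedTuran {a : ℝ}
    (h : ∃ᶠ y : ℝ in atTop, a < normalizedTuran y) :
    ∃ᶠ x : ℝ in atTop, a < liouvilleHarmonicSum x * Real.sqrt x := by
  rw [← Real.map_exp_atTop, Filter.frequently_map]
  refine h.mono fun y hy ↦ ?_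
  rw [← Real.exp_half]
  exact hy

/-- From `B(y) < a` frequently to `T(x) √x < a` frequently. [cite: BorweinFergusonMossinghoff2008, §1 (6) p. 1683] -/
theorem frequently_turan_lt_of_normalizedTuran {a : ℝ}
    (h : ∃ᶠ y : ℝ in atTop, normalizedTuran y < a) :
    ∃ᶠ x : ℝ in atTop, liouvilleHarmonicSum x * Real.sqrt x < a := by
  rw [← Real.map_exp_atTop, Filter.frequently_map]
  refine h.mono fun y hy ↦ ?_
  rw [← Real.exp_half]
  exact hy

/-- `B(log x) = T(x)√x` for `x > 0`. [cite: BorweinFergusonMossinghoff2008, §1 (6) p. 1683] -/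
theorem normalizedTuran_log {x : ℝ} (hx : 0 < x) :
    normalizedTuran (Real.log x) = liouvilleHarmonicSum x * Real.sqrt x := by
  unfold normalizedTuran
  rw [Real.exp_log hx, exp_log_half hx]

/-- A one-sided bound `B ≤ a` gives `T(x) ≤ a/√x` for `x > 0`. [folklore] -/
theorem turan_le_of_normalizedTuran_le {a : ℝ} (h : ∀ u, normalizedTuran u ≤ a) {x : ℝ}
    (hx : 0 < x) : liouvilleHarmonicSum x ≤ a / Real.sqrt x := by
  have h1 := h (Real.log x)
  rw [normalizedTuran_log hx] at h1
  rwa [le_div_iff₀ (Real.sqrt_pos.2 hx)]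

/-- A one-sided bound `-a ≤ B` gives `-(a/√x) ≤ T(x)` for `x > 0`. [folklore] -/
theorem turan_ge_of_le_normalizedTuran {a : ℝ} (h : ∀ u, -a ≤ normalizedTuran u) {x : ℝ}
    (hx : 0 < x) : -(a / Real.sqrt x) ≤ liouvilleHarmonicSum x := by
  have h1 := h (Real.log x)
  rw [normalizedTuran_log hx] at h1
  have hs := Real.sqrt_pos.2 hx
  have h2 : -liouvilleHarmonicSum x * Real.sqrt x ≤ a := by linarith
  have h3 : -liouvilleHarmonicSum x ≤ a / Real.sqrt x := by rwa [le_div_iff₀ hs]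
  linarith

/-! ## The substitution `x = e^u` -/

/-- The Mellin integrand of `T` vanishes a.e. off `(1, ∞)`. [folklore] -/
theorem turan_integrand_ae_zero {E : Type*} [NormedAddCommGroup E] [NormedSpace ℝ E] (φ : ℝ → E) :
    ∀ᵐ x : ℝ, x ∉ Set.Ioi (1 : ℝ) → liouvilleHarmonicSum x • φ x = 0 := by
  have h1 : ∀ᵐ x : ℝ, x ≠ 1 := by
    have : (volume : Measure ℝ) {1} = 0 := measure_singleton 1
    filter_upwards [compl_mem_ae_iff.2 this] with x hx
    simpa using hx
  filter_upwards [h1] with x hx hx1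
  have : x < 1 := lt_of_le_of_ne (not_lt.1 hx1) hx
  rw [liouvilleHarmonicSum_of_lt_one this]; simp

/-- **The Laplace transform of `B` is the Mellin transform of `T`**:
`∫_ℝ B(u) e^{-(s+½)u} du = ∫_{(1,∞)} T(x) x^{-(s+1)} dx` for every `s`.
[cite: BorweinFergusonMossinghoff2008, §1 (6) p. 1683] -/
theorem laplace_normalizedTuran_eq_mellin (s : ℂ) :
    ∫ u : ℝ, (normalizedTuran u : ℂ) * cexp (-((s + 1 / 2) * u)) =
      Landau.mellinIoi liouvilleHarmonicSum s := by
  unfold Landau.mellinIoi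
  set G : ℝ → ℂ := fun x ↦ ((liouvilleHarmonicSum x : ℝ) : ℂ) * (x : ℂ) ^ (-(s + 1)) with hG
  have h0 : ∫ x in Set.Ioi (1 : ℝ), G x = ∫ x in Set.Ioi (0 : ℝ), G x := by
    rw [setIntegral_eq_integral_of_ae_compl_eq_zero, setIntegral_eq_integral_of_ae_compl_eq_zero]
    · filter_upwards with x hx
      have : x < 1 := by simp only [Set.mem_Ioi, not_lt] at hx; linarith
      simp only [hG, liouvilleHarmonicSum_of_lt_one this]; simp
    · filter_upwards [turan_integrand_ae_zero (fun x : ℝ ↦ (x : ℂ) ^ (-(s + 1)))] with x hx hx1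
      have := hx hx1
      simp only [hG]
      rw [← Complex.real_smul] ; exact_mod_cast this
  rw [h0, integral_Ioi_eq_integral_exp]
  refine integral_congr_ae (ae_of_all _ fun u ↦ ?_)
  simp only [hG]
  unfold normalizedTuran
  rw [ofReal_exp_cpow, Complex.real_smul]
  push_cast
  have e : cexp ((u : ℂ) / 2) * cexp (-((s + 1 / 2) * (u : ℂ))) =
      cexp (u : ℂ) * cexp ((u : ℂ) * -(s + 1)) := by
    rw [← Complex.exp_add, ← Complex.exp_add]; congr 1; ring
  linear_combination (↑(liouvilleHarmonicSum (Real.exp u)) : ℂ) * e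

/-- Integrability transfers likewise: for real `σ`, `u ↦ B(u) e^{-σu}` is integrable on `ℝ` iff
`x ↦ T(x) x^{-((σ-½)+1)}` is integrable on `(1, ∞)`. [folklore] -/
theorem integrable_normalizedTuran_damped_iff (σ : ℝ) :
    Integrable (fun u : ℝ ↦ normalizedTuran u * Real.exp (-(σ * u))) ↔
      IntegrableOn (fun x : ℝ ↦ liouvilleHarmonicSum x * x ^ (-((σ - 1 / 2) + 1))) (Set.Ioi 1) := by
  set G : ℝ → ℝ := fun x ↦ liouvilleHarmonicSum x * x ^ (-((σ - 1 / 2) + 1)) with hG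
  have h1 : IntegrableOn G (Set.Ioi 1) ↔ IntegrableOn G (Set.Ioi 0) := by
    constructor
    · intro h
      have hsplit : Set.Ioi (0 : ℝ) = Set.Ioc 0 1 ∪ Set.Ioi 1 := (Set.Ioc_union_Ioi_eq_Ioi zero_le_one).symm
      rw [hsplit]
      refine IntegrableOn.union ?_ h
      refine (integrableOn_zero).congr_fun_ae ?_
      rw [EventuallyEq, ae_restrict_iff' measurableSet_Ioc]
      filter_upwards [turan_integrand_ae_zero (fun x : ℝ ↦ x ^ (-((σ - 1 / 2) + 1)))] with x hx hx1
      have : x ∉ Set.Ioi (1 : ℝ) := by simp only [Set.mem_Ioi, not_lt]; exact hx1.2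
      have := hx this
      rw [smul_eq_mul] at this
      simp only [hG]
      exact this.symm
    · exact fun h ↦ h.mono_set (Set.Ioi_subset_Ioi zero_le_one)
  rw [h1, integrableOn_Ioi_iff_integrable_exp]
  refine integrable_congr (ae_of_all _ fun u ↦ ?_)
  simp only [hG, smul_eq_mul]
  unfold normalizedTuran
  rw [Real.rpow_def_of_pos (Real.exp_pos u), Real.log_exp]
  have : Real.exp u * (liouvilleHarmonicSum (Real.exp u) * Real.exp (u * -((σ - 1 / 2) + 1))) =
      liouvilleHarmonicSum (Real.exp u) * (Real.exp u * Real.exp (u * -((σ - 1 / 2) + 1))) := by ring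
  rw [this, ← Real.exp_add, mul_assoc, ← Real.exp_add]
  congr 2; ring

/-! ## `1/√x` -/

/-- Integrability of `x^{-1/2} · x^{-(σ+1)}` (real) on `(1, ∞)` for `σ > -½`. [folklore] -/
theorem integrableOn_invSqrt_mul_rpow {σ : ℝ} (hσ : -(1 / 2 : ℝ) < σ) :
    IntegrableOn (fun x : ℝ ↦ x ^ (-(1 / 2 : ℝ)) * x ^ (-(σ + 1))) (Set.Ioi 1) := by
  have heq : EqOn (fun x : ℝ ↦ x ^ (-(σ + 3 / 2))) (fun x : ℝ ↦ x ^ (-(1 / 2 : ℝ)) * x ^ (-(σ + 1)))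
      (Set.Ioi 1) := by
    intro x hx
    have hx0 : 0 < x := by simp only [Set.mem_Ioi] at hx; linarith
    simp only
    rw [← Real.rpow_add hx0]
    congr 1; ring
  exact (integrableOn_Ioi_rpow_of_lt (by linarith) zero_lt_one).congr_fun heq measurableSet_Ioi

/-! ## Landau's theorem: a one-sided bound on `T(x)√x` forces absolute convergence for `σ > -½` -/

/-- **Landau's theorem applied to `T`** (the analytic content of Turán's theorem "if
`T(n) > -c/√n` for all sufficiently large `n`, then the Riemann hypothesis would follow", BFM 2008
§1 p. 1682, in integrated form): a one-sided bound `η T(x) ≤ A/√x` for `x ≥ x₁` (`η = ±1`) gives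
`∫_1^∞ |T(x)| x^{-σ-1} dx < ∞` for every `σ > -½`. The non-negative `g(x) = A x^{-1/2} - η T(x)` has
Mellin transform `A/(w+½) - η ζ(2w+2)/ζ₁(w+1)` (Mathlib's entire `ζ₁(s) = (s-1)ζ(s)`), holomorphic
on a neighbourhood of the real ray `(-½, ∞)` (`TuranLiouville.exists_strip_riemannZeta₁_ne_zero`,
`TuranLiouville.differentiableAt_continuation`). [cite: BorweinFergusonMossinghoff2008, §1 p. 1682; MontgomeryVaughan2007, §15.1 Lemma 15.1] -/
theorem integrableOn_turan_rpow_of_oneSided {A x₁ η : ℝ} (hη : η = 1 ∨ η = -1)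
    (hb : ∀ x, x₁ ≤ x → η * liouvilleHarmonicSum x ≤ A * x ^ (-(1 / 2 : ℝ))) {σ : ℝ}
    (hσ : -(1 / 2 : ℝ) < σ) :
    IntegrableOn (fun x ↦ liouvilleHarmonicSum x * x ^ (-(σ + 1))) (Set.Ioi 1) := by
  have hηsq : η * η = 1 := by rcases hη with rfl | rfl <;> norm_num
  -- the non-negative function `g = ε T + A x^{-1/2}`, `ε = -η` (the tree's `Turan1948.*gfun`)
  set ε : ℝ := -η with hε
  set g : ℝ → ℝ := fun x ↦ ε * liouvilleHarmonicSum x + A * x ^ (-(1 / 2 : ℝ)) with hg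
  have hgm : Measurable g := Turan1948.measurable_gfun ε A
  have hint : IntegrableOn (fun x ↦ g x * x ^ (-((2 : ℝ) + 1))) (Set.Ioi 1) :=
    Turan1948.integrableOn_gfun ε A
  have hX₁ : (1 : ℝ) ≤ max x₁ 1 := le_max_right _ _
  have hpos : ∀ x, max x₁ 1 < x → 0 ≤ g x := by
    intro x hx
    have := hb x ((le_max_left _ _).trans hx.le)
    simp only [hg, hε]
    linarith
  -- the continuation `Φ(s) = ε ζ(2s+2)/ζ₁(s+1) + A/(s+½)` on `{Re s > 2} ∪ W₀`
  obtain ⟨W₀, hW₀o, hW₀c, hW₀r, hW₀z⟩ := Turan1948.exists_W₀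
  set Φ : ℂ → ℂ := fun s ↦
    (ε : ℂ) * (riemannZeta (2 * s + 2) / riemannZeta₁ (s + 1)) + (A : ℂ) / (s + 1 / 2) with hΦ
  have hΦd : DifferentiableOn ℂ Φ ({s : ℂ | 2 < s.re} ∪ W₀) := by
    intro w hw
    apply DifferentiableAt.differentiableWithinAt
    rcases hw with hw | hw
    · simp only [Set.mem_setOf_eq] at hw
      have hw0 : w ≠ 0 := by rintro rfl; simp at hw; linarith
      refine Turan1948.differentiableAt_Phi (by linarith) ?_
      rw [riemannZeta₁_add_one hw0]
      exact mul_ne_zero hw0 (riemannZeta_ne_zero_of_one_lt_re (by simp; linarith))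
    · exact Turan1948.differentiableAt_Phi (hW₀z w hw).1 (hW₀z w hw).2
  have hagree : EqOn Φ (Landau.mellinIoi g) {s : ℂ | 2 < s.re} := by
    intro w hw
    simp only [Set.mem_setOf_eq] at hw
    have hw1 : 1 < w.re := by linarith
    have hw12 : -(1 / 2) < w.re := by linarith
    have h1 := Turan1948.mellinIoi_rpow_neg_half hw12
    have h2 := mellin_liouvilleHarmonicSum hw1
    unfold Landau.mellinIoi at h1 h2 ⊢
    have hsplit : ∀ x : ℝ, ((g x : ℝ) : ℂ) * (x : ℂ) ^ (-(w + 1)) =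
        (ε : ℂ) * (((liouvilleHarmonicSum x : ℝ) : ℂ) * (x : ℂ) ^ (-(w + 1))) +
          (A : ℂ) * ((((x ^ (-(1 / 2 : ℝ))) : ℝ) : ℂ) * (x : ℂ) ^ (-(w + 1))) := by
      intro x; simp only [hg]; push_cast; ring
    simp_rw [hsplit]
    rw [integral_add ((Turan1948.integrableOn_liouvilleHarmonicSum_mul_cpow hw1).const_mul _)
      ((Turan1948.integrableOn_rpow_neg_half_mul_cpow hw12).const_mul _), integral_const_mul,
      integral_const_mul, h1, h2]
    simp only [hΦ]
    ring
  -- Landau's lemma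
  have hL := Landau.integrableOn_of_differentiableOn_union_convex hgm hint hX₁ hpos
    (by norm_num : (-(1 / 2) : ℝ) < 2) hW₀o hW₀c
    (fun σ' h1 h2 ↦ hW₀r σ' (by linarith) (by linarith)) hΦd hagree hσ
  -- back to `T = η (A x^{-1/2} - g)`
  have hM : ∀ x : ℝ, liouvilleHarmonicSum x * x ^ (-(σ + 1)) =
      η * A * (x ^ (-(1 / 2 : ℝ)) * x ^ (-(σ + 1))) - η * (g x * x ^ (-(σ + 1))) := by
    intro x
    simp only [hg, hε]
    linear_combination (-(liouvilleHarmonicSum x * x ^ (-(σ + 1)))) * hηsq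
  have : (fun x ↦ liouvilleHarmonicSum x * x ^ (-(σ + 1))) = fun x ↦
      η * A * (x ^ (-(1 / 2 : ℝ)) * x ^ (-(σ + 1))) - η * (g x * x ^ (-(σ + 1))) := funext hM
  rw [this]
  exact ((integrableOn_invSqrt_mul_rpow hσ).const_mul _).sub (hL.const_mul _)

/-! ## Analytic continuation: `∫_1^∞ T(x) x^{-w-1} dx = ζ(2w+2)/(w ζ(w+1))` on `Re w > -½` -/

/-- **The Mellin representation of `T` on `Re w > -½`**: if `∫_1^∞ |T(x)| x^{-σ-1} dx < ∞` for every
`σ > -½`, then `∫_1^∞ T(x) x^{-w-1} dx = ζ(2w+2)/(w ζ(w+1))` for `Re w > -½`, `w ≠ 0` — from the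
tree's continuation `TuranLiouville.mellinIoi_mul_riemannZeta₁_eq_of_integrable`
(`(∫ …) · ζ₁(w+1) = ζ(2w+2)`) and `ζ₁(w+1) = wζ(w+1) ≠ 0` (`ζ(2w+2) ≠ 0`). Under a one-sided bound
this is the step "the Riemann hypothesis would follow" of Turán's theorem (BFM 2008 §1 p. 1682).
[cite: BorweinFergusonMossinghoff2008, §1 pp. 1681–1682] -/
theorem mellin_turan_eq_of_integrable
    (hI : ∀ σ : ℝ, -(1 / 2 : ℝ) < σ → IntegrableOn (fun x ↦ liouvilleHarmonicSum x * x ^ (-(σ + 1))) (Set.Ioi 1))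
    {w : ℂ} (hw : -(1 / 2 : ℝ) < w.re) (hw0 : w ≠ 0) :
    Landau.mellinIoi liouvilleHarmonicSum w = riemannZeta (2 * w + 2) / (w * riemannZeta (w + 1)) := by
  have h := mellinIoi_mul_riemannZeta₁_eq_of_integrable (fun σ hσ ↦ hI σ (by linarith)) (u := w)
    (by linarith)
  rw [riemannZeta₁_add_one hw0] at h
  have hζ : w * riemannZeta (w + 1) ≠ 0 := by
    intro h0
    rw [h0, mul_zero] at h
    exact riemannZeta_ne_zero_of_one_lt_re (s := 2 * w + 2) (by simp; linarith) h.symm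
  rw [eq_div_iff hζ, h]

/-! ## The Laplace transform of `B` under a one-sided bound -/

/-- **The Laplace input of the kernel theorem for `T`** (BFM 2008 (6)–(7)): under a one-sided bound
`B ≤ a` or `B ≥ -a` on `B(u) = T(e^u)e^{u/2}`, the damped functions `B(u)e^{-σu}` are integrable
for every `σ > 0` (Landau), and for `0 < σ < ½` and all real `t`, with `s = σ + it`,
`∫ B(u) e^{-su} du = ζ(1+2s) · (1/(s-½)) / ζ(½+s)`.
[cite: BorweinFergusonMossinghoff2008, §1 (6)–(7) pp. 1683–1684] -/
theorem normalizedTuran_laplace_of_oneSided {a : ℝ}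
    (h : (∀ u, normalizedTuran u ≤ a) ∨ (∀ u, -a ≤ normalizedTuran u)) :
    (∀ σ : ℝ, 0 < σ → Integrable (fun u ↦ normalizedTuran u * Real.exp (-(σ * u)))) ∧
    ∀ σ t : ℝ, 0 < σ → σ < 1 / 2 →
      ∫ u : ℝ, (normalizedTuran u : ℂ) * cexp (-(((σ : ℂ) + t * I) * u)) =
        riemannZeta (1 + 2 * ((σ : ℂ) + t * I)) * (1 / (((σ : ℂ) + t * I) - 1 / 2)) /
          riemannZeta (1 / 2 + ((σ : ℂ) + t * I)) := by
  -- the one-sided bound in the `x`-variable and Landau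
  have hI : ∀ σ : ℝ, -(1 / 2 : ℝ) < σ →
      IntegrableOn (fun x ↦ liouvilleHarmonicSum x * x ^ (-(σ + 1))) (Set.Ioi 1) := by
    intro σ hσ
    have hsq : ∀ x : ℝ, 0 < x → x ^ (-(1 / 2 : ℝ)) = 1 / Real.sqrt x := by
      intro x hx
      rw [Real.rpow_neg hx.le, Real.sqrt_eq_rpow, inv_eq_one_div]
    rcases h with h | h
    · refine integrableOn_turan_rpow_of_oneSided (η := 1) (x₁ := 1) (A := a) (Or.inl rfl)
        (fun x hx ↦ ?_) hσ
      have hx0 : 0 < x := by linarith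
      rw [one_mul, hsq x hx0, ← div_eq_mul_one_div]
      exact turan_le_of_normalizedTuran_le h hx0
    · refine integrableOn_turan_rpow_of_oneSided (η := -1) (x₁ := 1) (A := a) (Or.inr rfl)
        (fun x hx ↦ ?_) hσ
      have hx0 : 0 < x := by linarith
      have := turan_ge_of_le_normalizedTuran h hx0
      rw [hsq x hx0, ← div_eq_mul_one_div]
      linarith
  refine ⟨fun σ hσ ↦ ?_, fun σ t hσ hσ' ↦ ?_⟩
  · rw [integrable_normalizedTuran_damped_iff]
    exact hI _ (by linarith)
  · set s : ℂ := (σ : ℂ) + t * I with hs_def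
    have hs : -(1 / 2 : ℝ) < (s - 1 / 2).re := by simp [hs_def]; linarith
    have hs0 : s - 1 / 2 ≠ 0 := by
      intro h1
      have := congrArg Complex.re h1
      simp [hs_def] at this; linarith
    have key := mellin_turan_eq_of_integrable hI hs hs0
    have hlap := laplace_normalizedTuran_eq_mellin (s - 1 / 2)
    rw [show s - 1 / 2 + 1 / 2 = s by ring] at hlap
    rw [hlap, key]
    have e1 : 2 * (s - 1 / 2) + 2 = 1 + 2 * s := by ring
    have e2 : s - 1 / 2 + 1 = 1 / 2 + s := by ring
    rw [e1, e2]
    field_simp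

end Literature.NumberTheory.LFunctions
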